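import Literature.NumberTheory.Rogawski1990.ArchStableOrbitalWallDerivOfClause    -- (D0-1) J1′ + (R1-e′)′ (this seat): the bottom of the clause-threaded chain
import Literature.NumberTheory.Rogawski1990.ArchStableOrbitalWallPackage          -- ★ p841698 (R1-e-pkg): `isFiniteMeasureOnCompacts_and_sigmaFinite_map_conj_of_injective`; brings ★ p841638 §1 (`differentiableAt_sum_integral_pi_update_map_conj_splitCurve`), ★ (δ8), ★ (R1-f)
import HarnessLib

/-!
# The wall constants as DATA, II: clause-threaded forms of the multi-family jump (R1-e″) and of the wall data package (R1-e-pkg) ((D0-2) of (R1-h-d); Rogawski 1990 §8.2, §14.5)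

Topic `NumberTheory/Rogawski1990`; namespace `Literature.NumberTheory.Rogawski1990`.  THEOREMS ONLY (no `def`, no instance, no notation, no axiom, no named fact, no `sorry`).
Cell `pub/hodgecm-mathlib`, ENGINE T1 (crux H413 = `stmt-HodgeConjecture-24833`); floor-2 road «(J-nc) in-house», brick (D0-2) of (R1-h-d) (LEAD F0P3a-plan (g9) WORD T8-119∕T8-120;
census `F0/P3a` bus 07:08:19Z); author F0P3a-p07 (g8), 2026-09-01.

WHAT.  The statements of ★ (R1-e″) p841638 `exists_tendsto_deriv_sin_mul_sum_sum_integral_pi_update_splitCurve`, of ★ p841698's `_of_eq` and of ★ p841698 `exists_wallCoef_hstep`, with the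
anonymous `∃ c, (c ≠ 0) ∧ …` replaced by «for the GIVEN family `c` (resp. `c v τ`), IF it satisfies the (J-nc) clause of ★ `ArchLimitFormulaNoncompactWall` on every relabelled group
`G_v(α∘τ)` with a noncompact `{0,2}`-wall at the data `(ντ v τ, z₁ v, νH v τ)` (the `hc` binder of ★ (b1) p842004 verbatim) THEN the same conclusion holds WITH THIS `c`»:
* **`tendsto_deriv_sin_mul_sum_sum_integral_pi_update_splitCurve_of_clause`** ((R1-e″)′) and its `ντ`-data form `…_of_eq_of_clause`;
* **`wallCoef_hstep_of_clause`** ((R1-e-pkg)′: `hWm ∧ hstep` for the scaled state with `κ_v(ρ) = (cw ? 2 : c v ρ⁻¹)`).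
Proofs = the ★ proofs with `obtain ⟨c, hc, hJ⟩ := …`∕`choose c hc hJ` replaced by the lower clause-threaded layer ((D0-1)).  (D0-3) re-threads ★ (R1-e-two) p841776 on top.
HONEST LABEL: HC_CM is proved only modulo the 7 printed citations until rung 0 closes; this file re-threads ★ proofs and pays nothing by itself.

## References
* [Rogawski1990] J. D. Rogawski, *Automorphic Representations of Unitary Groups in Three Variables*, Ann. of Math. Stud. 123 (1990), §8.2 pp. 119, 122–124, §14.5 pp. 238–239.
* [Varadarajan1989] V. S. Varadarajan, *An Introduction to Harmonic Analysis on Semisimple Lie Groups* (1989), §6.4 Thm 22.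
* [DeitmarEchterhoff2014] A. Deitmar, S. Echterhoff, *Principles of Harmonic Analysis*, 2nd ed. (2014), Lemma 9.3.3.
-/

set_option autoImplicit false

noncomputable section

open MeasureTheory Measure Filter Topology NumberField NumberField.InfinitePlace NumberField.mixedEmbedding Equiv Function Set
open Literature.MeasureTheory.Group Literature.NumberTheory.Automorphic Literature.NumberTheory.Automorphic.UnitaryGroup
open Literature.LinearAlgebra.Matrix
open scoped Matrix MatrixGroups Matrix.Norms.Operator ContDiff

namespace Literature.NumberTheory.Rogawski1990

/-! ## §1 (R1-e″)′: the multi-family one-step jump at one place -/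

section OnePlace

variable (L : Type) [Field L] [NumberField L] [IsCMField L] (α : Fin 3 → L) (w : {w : InfinitePlace L // IsComplex w})
  [MeasurableSpace (GL (Fin 3) ℂ)] [BorelSpace (GL (Fin 3) ℂ)]
  [MeasurableSpace (arch (↥(maximalRealSubfield L)) L (IsCMField.complexConj L) 3 (Matrix.diagonal α))] [BorelSpace (arch (↥(maximalRealSubfield L)) L (IsCMField.complexConj L) 3 (Matrix.diagonal α))]

open scoped Classical in
/-- **(R1-e″)′ THE MULTI-FAMILY ONE-STEP JUMP WITH THE WALL CONSTANTS AS DATA** (clause-threaded form of ★ (R1-e″) p841638 `exists_tendsto_deriv_sin_mul_sum_sum_integral_pi_update_splitCurve`: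
same statement with `∃ c, (c ≠ 0) ∧ …` replaced by «for the given `c`, IF `c τ` satisfies the (J-nc) clause on every relabelled group with a noncompact `{0,2}`-wall THEN …»; same proof over
(R1-e′)′). [cite: Rogawski1990, §8.2 p. 124; §14.5 p. 238] [cite: Varadarajan1989, §6.4 Thm 22] -/
theorem tendsto_deriv_sin_mul_sum_sum_integral_pi_update_splitCurve_of_clause
    (hα : ∀ i, α i ≠ 0) (hherm : ∀ i, (IsCMField.complexConj L (α i) : L) = α i)
    (ν : Measure (archLocal L 3 (Matrix.diagonal α) w)) [ν.IsHaarMeasure] [ν.IsMulRightInvariant]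
    (z₁ : Fin 3 → Circle) (h02 : z₁ 0 = z₁ 2) (h01 : z₁ 0 ≠ z₁ 1)
    [∀ τ : Perm (Fin 3), MeasurableSpace (archLocal L 3 (Matrix.diagonal (α ∘ ⇑τ)) w ⧸ Subgroup.centralizer
      ({(⟨circleDiagonal 3 z₁, circleDiagonal_mem_archLocal_diagonal L 3 (α ∘ ⇑τ) w z₁⟩ : archLocal L 3 (Matrix.diagonal (α ∘ ⇑τ)) w)} :
        Set (archLocal L 3 (Matrix.diagonal (α ∘ ⇑τ)) w)))]
    [∀ τ : Perm (Fin 3), BorelSpace (archLocal L 3 (Matrix.diagonal (α ∘ ⇑τ)) w ⧸ Subgroup.centralizer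
      ({(⟨circleDiagonal 3 z₁, circleDiagonal_mem_archLocal_diagonal L 3 (α ∘ ⇑τ) w z₁⟩ : archLocal L 3 (Matrix.diagonal (α ∘ ⇑τ)) w)} :
        Set (archLocal L 3 (Matrix.diagonal (α ∘ ⇑τ)) w)))]
    (νH : ∀ τ : Perm (Fin 3), Measure (Subgroup.centralizer
      ({(⟨circleDiagonal 3 z₁, circleDiagonal_mem_archLocal_diagonal L 3 (α ∘ ⇑τ) w z₁⟩ : archLocal L 3 (Matrix.diagonal (α ∘ ⇑τ)) w)} :
        Set (archLocal L 3 (Matrix.diagonal (α ∘ ⇑τ)) w))))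
    [∀ τ, (νH τ).IsHaarMeasure] [∀ τ, (νH τ).IsInvInvariant] (c : Perm (Fin 3) → ℂ) :
    haveI : ∀ τ : Perm (Fin 3), LocallyCompactSpace (archLocal L 3 (Matrix.diagonal (α ∘ ⇑τ)) w) := fun τ => locallyCompactSpace_archLocal L 3 (Matrix.diagonal (α ∘ ⇑τ)) w
    haveI : ∀ τ : Perm (Fin 3), SecondCountableTopology (archLocal L 3 (Matrix.diagonal (α ∘ ⇑τ)) w) := fun τ => secondCountableTopology_archLocal L 3 (Matrix.diagonal (α ∘ ⇑τ)) w
    haveI : ∀ τ : Perm (Fin 3), (ν.map (ContinuousMulEquiv.restrictSubgroup (GLn.conjEquiv (Matrix.GeneralLinearGroup.mkOfDetNeZero _ (det_monomial_one_ne_zero 3 τ)))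
            (archLocal L 3 (Matrix.diagonal (α ∘ ⇑τ)) w) (archLocal L 3 (Matrix.diagonal α) w)
            (mem_archLocal_comp_perm_iff_conj_mem L 3 α w τ)).symm).IsMulRightInvariant := fun τ => isMulRightInvariant_map_relabel_symm L 3 α w τ ν
    haveI : ∀ τ : Perm (Fin 3), (ν.map (ContinuousMulEquiv.restrictSubgroup (GLn.conjEquiv (Matrix.GeneralLinearGroup.mkOfDetNeZero _ (det_monomial_one_ne_zero 3 τ)))
            (archLocal L 3 (Matrix.diagonal (α ∘ ⇑τ)) w) (archLocal L 3 (Matrix.diagonal α) w)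
            (mem_archLocal_comp_perm_iff_conj_mem L 3 α w τ)).symm).IsHaarMeasure := fun _ => ContinuousMulEquiv.isHaarMeasure_map ν _
    (∀ (τ : Perm (Fin 3)), (w.1.embedding (α (τ 0))).re * (w.1.embedding (α (τ 2))).re < 0 →
      ∀ (Θ : Matrix (Fin 3) (Fin 3) ℂ → ℂ), ContDiff ℝ (⊤ : ℕ∞) Θ →
        HasCompactSupport (fun k : archLocal L 3 (Matrix.diagonal (α ∘ ⇑τ)) w => Θ ((k : GL (Fin 3) ℂ) : Matrix (Fin 3) (Fin 3) ℂ)) →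
        ∀ (z₀ : Fin 3 → Circle) (h02' : z₀ 0 = z₀ 2) (h01' : z₀ 0 ≠ z₀ 1),
          Tendsto (fun ψ : ℝ => deriv (fun ψ : ℝ => (2 * Real.sin ψ : ℂ) *
              ∫ g, Θ (((g * ⟨circleDiagonal 3 (fun i => z₀ i * Circle.exp (![(1 : ℝ), 0, -1] i * ψ)),
                circleDiagonal_mem_archLocal_diagonal L 3 (α ∘ ⇑τ) w _⟩ * g⁻¹ : archLocal L 3 (Matrix.diagonal (α ∘ ⇑τ)) w) : GL (Fin 3) ℂ) : Matrix (Fin 3) (Fin 3) ℂ)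
                ∂(ν.map (ContinuousMulEquiv.restrictSubgroup (GLn.conjEquiv (Matrix.GeneralLinearGroup.mkOfDetNeZero _ (det_monomial_one_ne_zero 3 τ)))
            (archLocal L 3 (Matrix.diagonal (α ∘ ⇑τ)) w) (archLocal L 3 (Matrix.diagonal α) w)
            (mem_archLocal_comp_perm_iff_conj_mem L 3 α w τ)).symm)) ψ)
            (𝓝[≠] 0)
            (𝓝 (c τ * ∫ y, descConj (⟨circleDiagonal 3 z₀, circleDiagonal_mem_archLocal_diagonal L 3 (α ∘ ⇑τ) w z₀⟩ : archLocal L 3 (Matrix.diagonal (α ∘ ⇑τ)) w)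
              (Subgroup.centralizer ({(⟨circleDiagonal 3 z₁, circleDiagonal_mem_archLocal_diagonal L 3 (α ∘ ⇑τ) w z₁⟩ : archLocal L 3 (Matrix.diagonal (α ∘ ⇑τ)) w)} :
                Set (archLocal L 3 (Matrix.diagonal (α ∘ ⇑τ)) w)))
              (forall_mem_centralizer_circleDiagonal_comm_of_wall L (α ∘ ⇑τ) w h02 h01 h02' h01')
              (fun k : archLocal L 3 (Matrix.diagonal (α ∘ ⇑τ)) w => Θ ((k : GL (Fin 3) ℂ) : Matrix (Fin 3) (Fin 3) ℂ)) y
              ∂(quotientMeasure _ (νH τ) (isClosed_coe_centralizer_singleton _)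
                (ν.map (ContinuousMulEquiv.restrictSubgroup (GLn.conjEquiv (Matrix.GeneralLinearGroup.mkOfDetNeZero _ (det_monomial_one_ne_zero 3 τ)))
            (archLocal L 3 (Matrix.diagonal (α ∘ ⇑τ)) w) (archLocal L 3 (Matrix.diagonal α) w)
            (mem_archLocal_comp_perm_iff_conj_mem L 3 α w τ)).symm))))) →
      ∀ (Θ : Matrix (Fin 3) (Fin 3) (mixedSpace L) → ℂ), ContDiff ℝ (⊤ : ℕ∞) Θ →
        HasCompactSupport (fun g : arch (↥(maximalRealSubfield L)) L (IsCMField.complexConj L) 3 (Matrix.diagonal α) => Θ ((g : GL (Fin 3) (mixedSpace L)) : Matrix (Fin 3) (Fin 3) (mixedSpace L))) →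
        ∀ (ι : Type) [Fintype ι] (s : ι → ℂ) (μfam : ι → ∀ v : {w : InfinitePlace L // IsComplex w}, Measure (archLocal L 3 (Matrix.diagonal α) v)),
        (∀ i v, IsFiniteMeasureOnCompacts (μfam i v) ∧ SigmaFinite (μfam i v)) →
        ∀ (z₀ : Fin 3 → Circle) (h02' : z₀ 0 = z₀ 2) (h01' : z₀ 0 ≠ z₀ 1),
          Tendsto (fun ψ : ℝ => deriv (fun ψ : ℝ => (2 * Real.sin ψ : ℂ) * ∑ i, s i * ∑ ρ : Perm (Fin 3),
              ∫ o, Θ ((((archPiEquivCM 3 L (Matrix.diagonal α)).symm o : arch (↥(maximalRealSubfield L)) L (IsCMField.complexConj L) 3 (Matrix.diagonal α)) : GL (Fin 3) (mixedSpace L)) : Matrix (Fin 3) (Fin 3) (mixedSpace L))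
                ∂(Measure.pi (Function.update (μfam i) w (ν.map fun y : archLocal L 3 (Matrix.diagonal α) w => y * (⟨circleDiagonal 3 ((fun i => z₀ i * Circle.exp (![(1 : ℝ), 0, -1] i * ψ)) ∘ ⇑ρ), circleDiagonal_mem_archLocal_diagonal L 3 α w ((fun i => z₀ i * Circle.exp (![(1 : ℝ), 0, -1] i * ψ)) ∘ ⇑ρ)⟩ : archLocal L 3 (Matrix.diagonal α) w) * y⁻¹)))) ψ)
            (𝓝[>] 0)
            (𝓝 (∑ i, s i * ∑ ρ : Perm (Fin 3),
              (if 0 < (w.1.embedding (α (ρ⁻¹ 0))).re * (w.1.embedding (α (ρ⁻¹ 2))).re then (2 : ℂ) else c ρ⁻¹) *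
                ∫ o, Θ ((((archPiEquivCM 3 L (Matrix.diagonal α)).symm o : arch (↥(maximalRealSubfield L)) L (IsCMField.complexConj L) 3 (Matrix.diagonal α)) : GL (Fin 3) (mixedSpace L)) : Matrix (Fin 3) (Fin 3) (mixedSpace L))
                ∂(Measure.pi (Function.update (μfam i) w (if 0 < (w.1.embedding (α (ρ⁻¹ 0))).re * (w.1.embedding (α (ρ⁻¹ 2))).re then ν.map fun y : archLocal L 3 (Matrix.diagonal α) w => y * (⟨circleDiagonal 3 (z₀ ∘ ⇑ρ), circleDiagonal_mem_archLocal_diagonal L 3 α w (z₀ ∘ ⇑ρ)⟩ : archLocal L 3 (Matrix.diagonal α) w) * y⁻¹ else ((quotientMeasure _ (νH ρ⁻¹) (isClosed_coe_centralizer_singleton _) (ν.map (ContinuousMulEquiv.restrictSubgroup (GLn.conjEquiv (Matrix.GeneralLinearGroup.mkOfDetNeZero _ (det_monomial_one_ne_zero 3 ρ⁻¹)))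
            (archLocal L 3 (Matrix.diagonal (α ∘ ⇑ρ⁻¹)) w) (archLocal L 3 (Matrix.diagonal α) w)
            (mem_archLocal_comp_perm_iff_conj_mem L 3 α w ρ⁻¹)).symm)).map
                  (descConj (⟨circleDiagonal 3 z₀, circleDiagonal_mem_archLocal_diagonal L 3 (α ∘ ⇑ρ⁻¹) w z₀⟩ : archLocal L 3 (Matrix.diagonal (α ∘ ⇑ρ⁻¹)) w)
                    (Subgroup.centralizer ({(⟨circleDiagonal 3 z₁, circleDiagonal_mem_archLocal_diagonal L 3 (α ∘ ⇑ρ⁻¹) w z₁⟩ :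
                      archLocal L 3 (Matrix.diagonal (α ∘ ⇑ρ⁻¹)) w)} : Set (archLocal L 3 (Matrix.diagonal (α ∘ ⇑ρ⁻¹)) w)))
                    (forall_mem_centralizer_circleDiagonal_comm_of_wall L (α ∘ ⇑ρ⁻¹) w h02 h01 h02' h01') id)).map
                  (ContinuousMulEquiv.restrictSubgroup (GLn.conjEquiv (Matrix.GeneralLinearGroup.mkOfDetNeZero _ (det_monomial_one_ne_zero 3 ρ⁻¹)))
            (archLocal L 3 (Matrix.diagonal (α ∘ ⇑ρ⁻¹)) w) (archLocal L 3 (Matrix.diagonal α) w)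
            (mem_archLocal_comp_perm_iff_conj_mem L 3 α w ρ⁻¹))))))) := by
  classical
  haveI hLC : ∀ τ : Perm (Fin 3), LocallyCompactSpace (archLocal L 3 (Matrix.diagonal (α ∘ ⇑τ)) w) :=
    fun τ => locallyCompactSpace_archLocal L 3 (Matrix.diagonal (α ∘ ⇑τ)) w
  haveI hSC : ∀ τ : Perm (Fin 3), SecondCountableTopology (archLocal L 3 (Matrix.diagonal (α ∘ ⇑τ)) w) :=
    fun τ => secondCountableTopology_archLocal L 3 (Matrix.diagonal (α ∘ ⇑τ)) w
  haveI hLCv : ∀ v : {w : InfinitePlace L // IsComplex w}, LocallyCompactSpace (archLocal L 3 (Matrix.diagonal α) v) := fun v => locallyCompactSpace_archLocal L 3 (Matrix.diagonal α) v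
  haveI hSCv : ∀ v : {w : InfinitePlace L // IsComplex w}, SecondCountableTopology (archLocal L 3 (Matrix.diagonal α) v) := fun v => secondCountableTopology_archLocal L 3 (Matrix.diagonal α) v
  intro hcl Θ hΘ hΘc ι _ s μfam hμ z₀ h02' h01'
  have hJ := tendsto_deriv_sin_mul_sum_integral_pi_update_splitCurve_of_clause L α w hα hherm ν z₁ h02 h01 νH c hcl
  haveI : ∀ i v, IsFiniteMeasureOnCompacts (μfam i v) := fun i v => (hμ i v).1
  haveI : ∀ i v, SigmaFinite (μfam i v) := fun i v => (hμ i v).2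
  -- the single-family jumps
  have hJi := fun i => hJ Θ hΘ hΘc (μfam i) z₀ h02' h01'
  -- the regularity window
  have hev : ∀ᶠ ψ in 𝓝[>] (0 : ℝ), Function.Injective (fun i => z₀ i * Circle.exp (![(1 : ℝ), 0, -1] i * ψ)) :=
    (eventually_injective_splitCurve z₀ h02' h01').filter_mono (nhdsWithin_mono _ fun x (hx : 0 < x) => ne_of_gt hx)
  -- on the window, the derivative of the combination is the combination of the derivatives
  have hderiv : ∀ᶠ ψ in 𝓝[>] (0 : ℝ),
      deriv (fun ψ : ℝ => (2 * Real.sin ψ : ℂ) * ∑ i, s i * ∑ ρ : Perm (Fin 3),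
        ∫ o, Θ ((((archPiEquivCM 3 L (Matrix.diagonal α)).symm o : arch (↥(maximalRealSubfield L)) L (IsCMField.complexConj L) 3 (Matrix.diagonal α)) : GL (Fin 3) (mixedSpace L)) : Matrix (Fin 3) (Fin 3) (mixedSpace L))
                ∂(Measure.pi (Function.update (μfam i) w (ν.map fun y : archLocal L 3 (Matrix.diagonal α) w => y * (⟨circleDiagonal 3 ((fun i => z₀ i * Circle.exp (![(1 : ℝ), 0, -1] i * ψ)) ∘ ⇑ρ), circleDiagonal_mem_archLocal_diagonal L 3 α w ((fun i => z₀ i * Circle.exp (![(1 : ℝ), 0, -1] i * ψ)) ∘ ⇑ρ)⟩ : archLocal L 3 (Matrix.diagonal α) w) * y⁻¹)))) ψ =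
      ∑ i, s i * deriv (fun ψ : ℝ => (2 * Real.sin ψ : ℂ) * ∑ ρ : Perm (Fin 3),
        ∫ o, Θ ((((archPiEquivCM 3 L (Matrix.diagonal α)).symm o : arch (↥(maximalRealSubfield L)) L (IsCMField.complexConj L) 3 (Matrix.diagonal α)) : GL (Fin 3) (mixedSpace L)) : Matrix (Fin 3) (Fin 3) (mixedSpace L))
                ∂(Measure.pi (Function.update (μfam i) w (ν.map fun y : archLocal L 3 (Matrix.diagonal α) w => y * (⟨circleDiagonal 3 ((fun i => z₀ i * Circle.exp (![(1 : ℝ), 0, -1] i * ψ)) ∘ ⇑ρ), circleDiagonal_mem_archLocal_diagonal L 3 α w ((fun i => z₀ i * Circle.exp (![(1 : ℝ), 0, -1] i * ψ)) ∘ ⇑ρ)⟩ : archLocal L 3 (Matrix.diagonal α) w) * y⁻¹)))) ψ := by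
    filter_upwards [hev] with ψ hψ
    have hsin : DifferentiableAt ℝ (fun ψ : ℝ => (2 * Real.sin ψ : ℂ)) ψ :=
      (((Real.hasDerivAt_sin ψ).ofReal_comp).const_mul (2 : ℂ)).differentiableAt
    have hF : ∀ i, DifferentiableAt ℝ (fun ψ : ℝ => (2 * Real.sin ψ : ℂ) * ∑ ρ : Perm (Fin 3),
        ∫ o, Θ ((((archPiEquivCM 3 L (Matrix.diagonal α)).symm o : arch (↥(maximalRealSubfield L)) L (IsCMField.complexConj L) 3 (Matrix.diagonal α)) : GL (Fin 3) (mixedSpace L)) : Matrix (Fin 3) (Fin 3) (mixedSpace L))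
                ∂(Measure.pi (Function.update (μfam i) w (ν.map fun y : archLocal L 3 (Matrix.diagonal α) w => y * (⟨circleDiagonal 3 ((fun i => z₀ i * Circle.exp (![(1 : ℝ), 0, -1] i * ψ)) ∘ ⇑ρ), circleDiagonal_mem_archLocal_diagonal L 3 α w ((fun i => z₀ i * Circle.exp (![(1 : ℝ), 0, -1] i * ψ)) ∘ ⇑ρ)⟩ : archLocal L 3 (Matrix.diagonal α) w) * y⁻¹)))) ψ := fun i =>
      hsin.mul (differentiableAt_sum_integral_pi_update_map_conj_splitCurve L α w hα hherm ν Θ hΘ hΘc (μfam i) z₀ hψ)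
    have hfun : (fun ψ : ℝ => (2 * Real.sin ψ : ℂ) * ∑ i, s i * ∑ ρ : Perm (Fin 3),
        ∫ o, Θ ((((archPiEquivCM 3 L (Matrix.diagonal α)).symm o : arch (↥(maximalRealSubfield L)) L (IsCMField.complexConj L) 3 (Matrix.diagonal α)) : GL (Fin 3) (mixedSpace L)) : Matrix (Fin 3) (Fin 3) (mixedSpace L))
                ∂(Measure.pi (Function.update (μfam i) w (ν.map fun y : archLocal L 3 (Matrix.diagonal α) w => y * (⟨circleDiagonal 3 ((fun i => z₀ i * Circle.exp (![(1 : ℝ), 0, -1] i * ψ)) ∘ ⇑ρ), circleDiagonal_mem_archLocal_diagonal L 3 α w ((fun i => z₀ i * Circle.exp (![(1 : ℝ), 0, -1] i * ψ)) ∘ ⇑ρ)⟩ : archLocal L 3 (Matrix.diagonal α) w) * y⁻¹)))) =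
        ∑ i, fun ψ : ℝ => s i * ((2 * Real.sin ψ : ℂ) * ∑ ρ : Perm (Fin 3),
          ∫ o, Θ ((((archPiEquivCM 3 L (Matrix.diagonal α)).symm o : arch (↥(maximalRealSubfield L)) L (IsCMField.complexConj L) 3 (Matrix.diagonal α)) : GL (Fin 3) (mixedSpace L)) : Matrix (Fin 3) (Fin 3) (mixedSpace L))
                ∂(Measure.pi (Function.update (μfam i) w (ν.map fun y : archLocal L 3 (Matrix.diagonal α) w => y * (⟨circleDiagonal 3 ((fun i => z₀ i * Circle.exp (![(1 : ℝ), 0, -1] i * ψ)) ∘ ⇑ρ), circleDiagonal_mem_archLocal_diagonal L 3 α w ((fun i => z₀ i * Circle.exp (![(1 : ℝ), 0, -1] i * ψ)) ∘ ⇑ρ)⟩ : archLocal L 3 (Matrix.diagonal α) w) * y⁻¹)))) := by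
      funext ψ
      rw [Finset.sum_apply, Finset.mul_sum]
      exact Finset.sum_congr rfl fun i _ => by ring
    rw [hfun, deriv_sum fun i _ => (hF i).const_mul (s i)]
    exact Finset.sum_congr rfl fun i _ => deriv_const_mul (s i) (hF i)
  -- sum the single-family limits and reshape the right-hand side
  have hsum := tendsto_finsetSum (Finset.univ : Finset ι) fun i _ => (hJi i).const_mul (s i)
  have h2 := hsum.congr' (hderiv.mono fun ψ h => h.symm)
  convert h2 using 2
  refine Finset.sum_congr rfl fun i _ => ?_
  congr 1
  refine Finset.sum_congr rfl fun ρ _ => ?_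
  split_ifs <;> rfl

end OnePlace

/-! ## §2 (R1-e-pkg)′: the wall data package of one diagonal carrier, all places -/

section AllPlaces

variable (L : Type) [Field L] [NumberField L] [IsCMField L] (α : Fin 3 → L)
  [MeasurableSpace (GL (Fin 3) ℂ)] [BorelSpace (GL (Fin 3) ℂ)]
  [MeasurableSpace (arch (↥(maximalRealSubfield L)) L (IsCMField.complexConj L) 3 (Matrix.diagonal α))] [BorelSpace (arch (↥(maximalRealSubfield L)) L (IsCMField.complexConj L) 3 (Matrix.diagonal α))]

open scoped Classical in
/-- (R1-e″)′ with the transported Haar measures `ν.map e_τ⁻¹` passed as DATA `ντ` (the clause is then read AT `ντ τ`; cf. ★ p841698's `_of_eq`). [cite: Rogawski1990, §8.2 p. 124] -/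
theorem tendsto_deriv_sin_mul_sum_sum_integral_pi_update_splitCurve_of_eq_of_clause (w : {w : InfinitePlace L // IsComplex w})
    (hα : ∀ i, α i ≠ 0) (hherm : ∀ i, (IsCMField.complexConj L (α i) : L) = α i)
    (ν : Measure (archLocal L 3 (Matrix.diagonal α) w)) [ν.IsHaarMeasure] [ν.IsMulRightInvariant]
    (z₁ : Fin 3 → Circle) (h02 : z₁ 0 = z₁ 2) (h01 : z₁ 0 ≠ z₁ 1)
    [∀ τ : Perm (Fin 3), MeasurableSpace (archLocal L 3 (Matrix.diagonal (α ∘ ⇑τ)) w ⧸ Subgroup.centralizer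
      ({(⟨circleDiagonal 3 z₁, circleDiagonal_mem_archLocal_diagonal L 3 (α ∘ ⇑τ) w z₁⟩ : archLocal L 3 (Matrix.diagonal (α ∘ ⇑τ)) w)} :
        Set (archLocal L 3 (Matrix.diagonal (α ∘ ⇑τ)) w)))]
    [∀ τ : Perm (Fin 3), BorelSpace (archLocal L 3 (Matrix.diagonal (α ∘ ⇑τ)) w ⧸ Subgroup.centralizer
      ({(⟨circleDiagonal 3 z₁, circleDiagonal_mem_archLocal_diagonal L 3 (α ∘ ⇑τ) w z₁⟩ : archLocal L 3 (Matrix.diagonal (α ∘ ⇑τ)) w)} :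
        Set (archLocal L 3 (Matrix.diagonal (α ∘ ⇑τ)) w)))]
    (νH : ∀ τ : Perm (Fin 3), Measure (Subgroup.centralizer
      ({(⟨circleDiagonal 3 z₁, circleDiagonal_mem_archLocal_diagonal L 3 (α ∘ ⇑τ) w z₁⟩ : archLocal L 3 (Matrix.diagonal (α ∘ ⇑τ)) w)} :
        Set (archLocal L 3 (Matrix.diagonal (α ∘ ⇑τ)) w))))
    [∀ τ, (νH τ).IsHaarMeasure] [∀ τ, (νH τ).IsInvInvariant]
    (ντ : ∀ τ : Perm (Fin 3), Measure (archLocal L 3 (Matrix.diagonal (α ∘ ⇑τ)) w))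
    [∀ τ, (ντ τ).IsHaarMeasure] [∀ τ, (ντ τ).IsMulRightInvariant]
    (hντ : ντ = fun τ => ν.map (ContinuousMulEquiv.restrictSubgroup (GLn.conjEquiv (Matrix.GeneralLinearGroup.mkOfDetNeZero _ (det_monomial_one_ne_zero 3 τ)))
            (archLocal L 3 (Matrix.diagonal (α ∘ ⇑τ)) w) (archLocal L 3 (Matrix.diagonal α) w)
            (mem_archLocal_comp_perm_iff_conj_mem L 3 α w τ)).symm) (c : Perm (Fin 3) → ℂ) :
    haveI : ∀ τ : Perm (Fin 3), LocallyCompactSpace (archLocal L 3 (Matrix.diagonal (α ∘ ⇑τ)) w) := fun τ => locallyCompactSpace_archLocal L 3 (Matrix.diagonal (α ∘ ⇑τ)) w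
    haveI : ∀ τ : Perm (Fin 3), SecondCountableTopology (archLocal L 3 (Matrix.diagonal (α ∘ ⇑τ)) w) := fun τ => secondCountableTopology_archLocal L 3 (Matrix.diagonal (α ∘ ⇑τ)) w
    (∀ (τ : Perm (Fin 3)), (w.1.embedding (α (τ 0))).re * (w.1.embedding (α (τ 2))).re < 0 →
      ∀ (Θ : Matrix (Fin 3) (Fin 3) ℂ → ℂ), ContDiff ℝ (⊤ : ℕ∞) Θ →
        HasCompactSupport (fun k : archLocal L 3 (Matrix.diagonal (α ∘ ⇑τ)) w => Θ ((k : GL (Fin 3) ℂ) : Matrix (Fin 3) (Fin 3) ℂ)) →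
        ∀ (z₀ : Fin 3 → Circle) (h02' : z₀ 0 = z₀ 2) (h01' : z₀ 0 ≠ z₀ 1),
          Tendsto (fun ψ : ℝ => deriv (fun ψ : ℝ => (2 * Real.sin ψ : ℂ) *
              ∫ g, Θ (((g * ⟨circleDiagonal 3 (fun i => z₀ i * Circle.exp (![(1 : ℝ), 0, -1] i * ψ)),
                circleDiagonal_mem_archLocal_diagonal L 3 (α ∘ ⇑τ) w _⟩ * g⁻¹ : archLocal L 3 (Matrix.diagonal (α ∘ ⇑τ)) w) : GL (Fin 3) ℂ) : Matrix (Fin 3) (Fin 3) ℂ)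
                ∂(ντ τ)) ψ)
            (𝓝[≠] 0)
            (𝓝 (c τ * ∫ y, descConj (⟨circleDiagonal 3 z₀, circleDiagonal_mem_archLocal_diagonal L 3 (α ∘ ⇑τ) w z₀⟩ : archLocal L 3 (Matrix.diagonal (α ∘ ⇑τ)) w)
              (Subgroup.centralizer ({(⟨circleDiagonal 3 z₁, circleDiagonal_mem_archLocal_diagonal L 3 (α ∘ ⇑τ) w z₁⟩ : archLocal L 3 (Matrix.diagonal (α ∘ ⇑τ)) w)} :
                Set (archLocal L 3 (Matrix.diagonal (α ∘ ⇑τ)) w)))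
              (forall_mem_centralizer_circleDiagonal_comm_of_wall L (α ∘ ⇑τ) w h02 h01 h02' h01')
              (fun k : archLocal L 3 (Matrix.diagonal (α ∘ ⇑τ)) w => Θ ((k : GL (Fin 3) ℂ) : Matrix (Fin 3) (Fin 3) ℂ)) y
              ∂(quotientMeasure _ (νH τ) (isClosed_coe_centralizer_singleton _)
                (ντ τ))))) →
      ∀ (Θ : Matrix (Fin 3) (Fin 3) (mixedSpace L) → ℂ), ContDiff ℝ (⊤ : ℕ∞) Θ →
        HasCompactSupport (fun g : arch (↥(maximalRealSubfield L)) L (IsCMField.complexConj L) 3 (Matrix.diagonal α) => Θ ((g : GL (Fin 3) (mixedSpace L)) : Matrix (Fin 3) (Fin 3) (mixedSpace L))) →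
        ∀ (ι : Type) [Fintype ι] (s : ι → ℂ) (μfam : ι → ∀ v : {w : InfinitePlace L // IsComplex w}, Measure (archLocal L 3 (Matrix.diagonal α) v)),
        (∀ i v, IsFiniteMeasureOnCompacts (μfam i v) ∧ SigmaFinite (μfam i v)) →
        ∀ (z₀ : Fin 3 → Circle) (h02' : z₀ 0 = z₀ 2) (h01' : z₀ 0 ≠ z₀ 1),
          Tendsto (fun ψ : ℝ => deriv (fun ψ : ℝ => (2 * Real.sin ψ : ℂ) * ∑ i, s i * ∑ ρ : Perm (Fin 3),
              ∫ o, Θ ((((archPiEquivCM 3 L (Matrix.diagonal α)).symm o : arch (↥(maximalRealSubfield L)) L (IsCMField.complexConj L) 3 (Matrix.diagonal α)) : GL (Fin 3) (mixedSpace L)) : Matrix (Fin 3) (Fin 3) (mixedSpace L))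
                ∂(Measure.pi (Function.update (μfam i) w (ν.map fun y : archLocal L 3 (Matrix.diagonal α) w => y * (⟨circleDiagonal 3 ((fun i => z₀ i * Circle.exp (![(1 : ℝ), 0, -1] i * ψ)) ∘ ⇑ρ), circleDiagonal_mem_archLocal_diagonal L 3 α w ((fun i => z₀ i * Circle.exp (![(1 : ℝ), 0, -1] i * ψ)) ∘ ⇑ρ)⟩ : archLocal L 3 (Matrix.diagonal α) w) * y⁻¹)))) ψ)
            (𝓝[>] 0)
            (𝓝 (∑ i, s i * ∑ ρ : Perm (Fin 3),
              (if 0 < (w.1.embedding (α (ρ⁻¹ 0))).re * (w.1.embedding (α (ρ⁻¹ 2))).re then (2 : ℂ) else c ρ⁻¹) *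
                ∫ o, Θ ((((archPiEquivCM 3 L (Matrix.diagonal α)).symm o : arch (↥(maximalRealSubfield L)) L (IsCMField.complexConj L) 3 (Matrix.diagonal α)) : GL (Fin 3) (mixedSpace L)) : Matrix (Fin 3) (Fin 3) (mixedSpace L))
                ∂(Measure.pi (Function.update (μfam i) w (if 0 < (w.1.embedding (α (ρ⁻¹ 0))).re * (w.1.embedding (α (ρ⁻¹ 2))).re then ν.map fun y : archLocal L 3 (Matrix.diagonal α) w => y * (⟨circleDiagonal 3 (z₀ ∘ ⇑ρ), circleDiagonal_mem_archLocal_diagonal L 3 α w (z₀ ∘ ⇑ρ)⟩ : archLocal L 3 (Matrix.diagonal α) w) * y⁻¹ else ((quotientMeasure _ (νH ρ⁻¹) (isClosed_coe_centralizer_singleton _) (ντ ρ⁻¹)).map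
                  (descConj (⟨circleDiagonal 3 z₀, circleDiagonal_mem_archLocal_diagonal L 3 (α ∘ ⇑ρ⁻¹) w z₀⟩ : archLocal L 3 (Matrix.diagonal (α ∘ ⇑ρ⁻¹)) w)
                    (Subgroup.centralizer ({(⟨circleDiagonal 3 z₁, circleDiagonal_mem_archLocal_diagonal L 3 (α ∘ ⇑ρ⁻¹) w z₁⟩ :
                      archLocal L 3 (Matrix.diagonal (α ∘ ⇑ρ⁻¹)) w)} : Set (archLocal L 3 (Matrix.diagonal (α ∘ ⇑ρ⁻¹)) w)))
                    (forall_mem_centralizer_circleDiagonal_comm_of_wall L (α ∘ ⇑ρ⁻¹) w h02 h01 h02' h01') id)).map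
                  (ContinuousMulEquiv.restrictSubgroup (GLn.conjEquiv (Matrix.GeneralLinearGroup.mkOfDetNeZero _ (det_monomial_one_ne_zero 3 ρ⁻¹)))
            (archLocal L 3 (Matrix.diagonal (α ∘ ⇑ρ⁻¹)) w) (archLocal L 3 (Matrix.diagonal α) w)
            (mem_archLocal_comp_perm_iff_conj_mem L 3 α w ρ⁻¹))))))) := by
  subst hντ
  exact tendsto_deriv_sin_mul_sum_sum_integral_pi_update_splitCurve_of_clause L α w hα hherm ν z₁ h02 h01 νH c

open scoped Classical in
/-- **(R1-e-pkg)′ THE WALL DATA PACKAGE WITH THE WALL CONSTANTS AS DATA** (clause-threaded form of ★ (R1-e-pkg) p841698 `exists_wallCoef_hstep`): for a family `c v τ` satisfying the (J-nc)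
clause at every place `v` and every relabelling `τ` with a noncompact `{0,2}`-wall (on `G_v(α∘τ)` at the data `(ντ v τ, z₁ v, νH v τ)`), (i) every wall measure `Wm_v(ρ)` is Radon
(as in ★ p841698 — independent of `c`) and (ii) the one-step jump law of ★ p841576's `hstep` holds at every place for the scaled state with `κ_v(ρ) = (cw ? 2 : c v ρ⁻¹)` — THIS `c`.
[cite: Rogawski1990, §8.2 p. 124; §14.5 p. 238–239] [cite: Varadarajan1989, §6.4 Thm 22] -/
theorem wallCoef_hstep_of_clause
    (hα : ∀ i, α i ≠ 0) (hherm : ∀ i, (IsCMField.complexConj L (α i) : L) = α i)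
    (z0 : {w : InfinitePlace L // IsComplex w} → Fin 3 → Circle) (hwall : ∀ v, z0 v 0 = z0 v 2 ∧ z0 v 0 ≠ z0 v 1)
    (νw : ∀ v : {w : InfinitePlace L // IsComplex w}, Measure (archLocal L 3 (Matrix.diagonal α) v)) (hνw : ∀ v, (νw v).IsHaarMeasure ∧ (νw v).IsMulRightInvariant)
    (z₁ : {w : InfinitePlace L // IsComplex w} → Fin 3 → Circle) (h02 : ∀ v, z₁ v 0 = z₁ v 2) (h01 : ∀ v, z₁ v 0 ≠ z₁ v 1)
    [∀ (v : {w : InfinitePlace L // IsComplex w}) (τ : Perm (Fin 3)), MeasurableSpace (archLocal L 3 (Matrix.diagonal (α ∘ ⇑τ)) v ⧸ Subgroup.centralizer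
      ({(⟨circleDiagonal 3 (z₁ v), circleDiagonal_mem_archLocal_diagonal L 3 (α ∘ ⇑τ) v (z₁ v)⟩ : archLocal L 3 (Matrix.diagonal (α ∘ ⇑τ)) v)} :
        Set (archLocal L 3 (Matrix.diagonal (α ∘ ⇑τ)) v)))]
    [∀ (v : {w : InfinitePlace L // IsComplex w}) (τ : Perm (Fin 3)), BorelSpace (archLocal L 3 (Matrix.diagonal (α ∘ ⇑τ)) v ⧸ Subgroup.centralizer
      ({(⟨circleDiagonal 3 (z₁ v), circleDiagonal_mem_archLocal_diagonal L 3 (α ∘ ⇑τ) v (z₁ v)⟩ : archLocal L 3 (Matrix.diagonal (α ∘ ⇑τ)) v)} :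
        Set (archLocal L 3 (Matrix.diagonal (α ∘ ⇑τ)) v)))]
    (νH : ∀ (v : {w : InfinitePlace L // IsComplex w}) (τ : Perm (Fin 3)), Measure (Subgroup.centralizer
      ({(⟨circleDiagonal 3 (z₁ v), circleDiagonal_mem_archLocal_diagonal L 3 (α ∘ ⇑τ) v (z₁ v)⟩ : archLocal L 3 (Matrix.diagonal (α ∘ ⇑τ)) v)} :
        Set (archLocal L 3 (Matrix.diagonal (α ∘ ⇑τ)) v))))
    (hνH : ∀ v τ, (νH v τ).IsHaarMeasure ∧ (νH v τ).IsInvInvariant)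
    (ντ : ∀ (v : {w : InfinitePlace L // IsComplex w}) (τ : Perm (Fin 3)), Measure (archLocal L 3 (Matrix.diagonal (α ∘ ⇑τ)) v))
    (hντi : ∀ v τ, (ντ v τ).IsHaarMeasure ∧ (ντ v τ).IsMulRightInvariant)
    (hντ : ντ = fun v τ => (νw v).map (ContinuousMulEquiv.restrictSubgroup (GLn.conjEquiv (Matrix.GeneralLinearGroup.mkOfDetNeZero _ (det_monomial_one_ne_zero 3 τ)))
              (archLocal L 3 (Matrix.diagonal (α ∘ ⇑τ)) v) (archLocal L 3 (Matrix.diagonal α) v)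
              (mem_archLocal_comp_perm_iff_conj_mem L 3 α v τ)).symm)
    (Θ : Matrix (Fin 3) (Fin 3) (mixedSpace L) → ℂ) (hΘ : ContDiff ℝ (⊤ : ℕ∞) Θ)
    (hΘc : HasCompactSupport fun g : arch (↥(maximalRealSubfield L)) L (IsCMField.complexConj L) 3 (Matrix.diagonal α) => Θ ((g : GL (Fin 3) (mixedSpace L)) : Matrix (Fin 3) (Fin 3) (mixedSpace L)))
    (c : {w : InfinitePlace L // IsComplex w} → Perm (Fin 3) → ℂ) :
    haveI : ∀ (v : {w : InfinitePlace L // IsComplex w}) (τ : Perm (Fin 3)), LocallyCompactSpace (archLocal L 3 (Matrix.diagonal (α ∘ ⇑τ)) v) := fun v τ => locallyCompactSpace_archLocal L 3 (Matrix.diagonal (α ∘ ⇑τ)) v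
    haveI : ∀ (v : {w : InfinitePlace L // IsComplex w}) (τ : Perm (Fin 3)), SecondCountableTopology (archLocal L 3 (Matrix.diagonal (α ∘ ⇑τ)) v) := fun v τ => secondCountableTopology_archLocal L 3 (Matrix.diagonal (α ∘ ⇑τ)) v
    haveI : ∀ v : {w : InfinitePlace L // IsComplex w}, (νw v).IsHaarMeasure := fun v => (hνw v).1
    haveI : ∀ v : {w : InfinitePlace L // IsComplex w}, (νw v).IsMulRightInvariant := fun v => (hνw v).2
    haveI : ∀ (v : {w : InfinitePlace L // IsComplex w}) (τ : Perm (Fin 3)), (νH v τ).IsHaarMeasure := fun v τ => (hνH v τ).1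
    haveI : ∀ (v : {w : InfinitePlace L // IsComplex w}) (τ : Perm (Fin 3)), (νH v τ).IsInvInvariant := fun v τ => (hνH v τ).2
    haveI : ∀ (v : {w : InfinitePlace L // IsComplex w}) (τ : Perm (Fin 3)), (ντ v τ).IsHaarMeasure := fun v τ => (hντi v τ).1
    haveI : ∀ (v : {w : InfinitePlace L // IsComplex w}) (τ : Perm (Fin 3)), (ντ v τ).IsMulRightInvariant := fun v τ => (hντi v τ).2
    (∀ (v : {w : InfinitePlace L // IsComplex w}), ∀ (τ : Perm (Fin 3)), (v.1.embedding (α (τ 0))).re * (v.1.embedding (α (τ 2))).re < 0 →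
      ∀ (Θ : Matrix (Fin 3) (Fin 3) ℂ → ℂ), ContDiff ℝ (⊤ : ℕ∞) Θ →
        HasCompactSupport (fun k : archLocal L 3 (Matrix.diagonal (α ∘ ⇑τ)) v => Θ ((k : GL (Fin 3) ℂ) : Matrix (Fin 3) (Fin 3) ℂ)) →
        ∀ (z₀ : Fin 3 → Circle) (h02' : z₀ 0 = z₀ 2) (h01' : z₀ 0 ≠ z₀ 1),
          Tendsto (fun ψ : ℝ => deriv (fun ψ : ℝ => (2 * Real.sin ψ : ℂ) *
              ∫ g, Θ (((g * ⟨circleDiagonal 3 (fun i => z₀ i * Circle.exp (![(1 : ℝ), 0, -1] i * ψ)),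
                circleDiagonal_mem_archLocal_diagonal L 3 (α ∘ ⇑τ) v _⟩ * g⁻¹ : archLocal L 3 (Matrix.diagonal (α ∘ ⇑τ)) v) : GL (Fin 3) ℂ) : Matrix (Fin 3) (Fin 3) ℂ)
                ∂(ντ v τ)) ψ)
            (𝓝[≠] 0)
            (𝓝 (c v τ * ∫ y, descConj (⟨circleDiagonal 3 z₀, circleDiagonal_mem_archLocal_diagonal L 3 (α ∘ ⇑τ) v z₀⟩ : archLocal L 3 (Matrix.diagonal (α ∘ ⇑τ)) v)
              (Subgroup.centralizer ({(⟨circleDiagonal 3 (z₁ v), circleDiagonal_mem_archLocal_diagonal L 3 (α ∘ ⇑τ) v (z₁ v)⟩ : archLocal L 3 (Matrix.diagonal (α ∘ ⇑τ)) v)} :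
                Set (archLocal L 3 (Matrix.diagonal (α ∘ ⇑τ)) v)))
              (forall_mem_centralizer_circleDiagonal_comm_of_wall L (α ∘ ⇑τ) v (h02 v) (h01 v) h02' h01')
              (fun k : archLocal L 3 (Matrix.diagonal (α ∘ ⇑τ)) v => Θ ((k : GL (Fin 3) ℂ) : Matrix (Fin 3) (Fin 3) ℂ)) y
              ∂(quotientMeasure _ (νH v τ) (isClosed_coe_centralizer_singleton _)
                (ντ v τ))))) →
      (∀ (v : {w : InfinitePlace L // IsComplex w}) (ρ : Perm (Fin 3)), IsFiniteMeasureOnCompacts (if 0 < (v.1.embedding (α (ρ⁻¹ 0))).re * (v.1.embedding (α (ρ⁻¹ 2))).re then (νw v).map fun y : archLocal L 3 (Matrix.diagonal α) v => y * (⟨circleDiagonal 3 (z0 v ∘ ⇑ρ), circleDiagonal_mem_archLocal_diagonal L 3 α v (z0 v ∘ ⇑ρ)⟩ : archLocal L 3 (Matrix.diagonal α) v) * y⁻¹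
              else ((quotientMeasure _ (νH v ρ⁻¹) (isClosed_coe_centralizer_singleton _) (ντ v ρ⁻¹)).map
                (descConj (⟨circleDiagonal 3 (z0 v), circleDiagonal_mem_archLocal_diagonal L 3 (α ∘ ⇑ρ⁻¹) v (z0 v)⟩ : archLocal L 3 (Matrix.diagonal (α ∘ ⇑ρ⁻¹)) v)
                  (Subgroup.centralizer ({(⟨circleDiagonal 3 (z₁ v), circleDiagonal_mem_archLocal_diagonal L 3 (α ∘ ⇑ρ⁻¹) v (z₁ v)⟩ :
                    archLocal L 3 (Matrix.diagonal (α ∘ ⇑ρ⁻¹)) v)} : Set (archLocal L 3 (Matrix.diagonal (α ∘ ⇑ρ⁻¹)) v)))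
                  (forall_mem_centralizer_circleDiagonal_comm_of_wall L (α ∘ ⇑ρ⁻¹) v (h02 v) (h01 v) (hwall v).1 (hwall v).2) id)).map
                (ContinuousMulEquiv.restrictSubgroup (GLn.conjEquiv (Matrix.GeneralLinearGroup.mkOfDetNeZero _ (det_monomial_one_ne_zero 3 ρ⁻¹)))
              (archLocal L 3 (Matrix.diagonal (α ∘ ⇑ρ⁻¹)) v) (archLocal L 3 (Matrix.diagonal α) v)
              (mem_archLocal_comp_perm_iff_conj_mem L 3 α v ρ⁻¹))) ∧ SigmaFinite (if 0 < (v.1.embedding (α (ρ⁻¹ 0))).re * (v.1.embedding (α (ρ⁻¹ 2))).re then (νw v).map fun y : archLocal L 3 (Matrix.diagonal α) v => y * (⟨circleDiagonal 3 (z0 v ∘ ⇑ρ), circleDiagonal_mem_archLocal_diagonal L 3 α v (z0 v ∘ ⇑ρ)⟩ : archLocal L 3 (Matrix.diagonal α) v) * y⁻¹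
              else ((quotientMeasure _ (νH v ρ⁻¹) (isClosed_coe_centralizer_singleton _) (ντ v ρ⁻¹)).map
                (descConj (⟨circleDiagonal 3 (z0 v), circleDiagonal_mem_archLocal_diagonal L 3 (α ∘ ⇑ρ⁻¹) v (z0 v)⟩ : archLocal L 3 (Matrix.diagonal (α ∘ ⇑ρ⁻¹)) v)
                  (Subgroup.centralizer ({(⟨circleDiagonal 3 (z₁ v), circleDiagonal_mem_archLocal_diagonal L 3 (α ∘ ⇑ρ⁻¹) v (z₁ v)⟩ :
                    archLocal L 3 (Matrix.diagonal (α ∘ ⇑ρ⁻¹)) v)} : Set (archLocal L 3 (Matrix.diagonal (α ∘ ⇑ρ⁻¹)) v)))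
                  (forall_mem_centralizer_circleDiagonal_comm_of_wall L (α ∘ ⇑ρ⁻¹) v (h02 v) (h01 v) (hwall v).1 (hwall v).2) id)).map
                (ContinuousMulEquiv.restrictSubgroup (GLn.conjEquiv (Matrix.GeneralLinearGroup.mkOfDetNeZero _ (det_monomial_one_ne_zero 3 ρ⁻¹)))
              (archLocal L 3 (Matrix.diagonal (α ∘ ⇑ρ⁻¹)) v) (archLocal L 3 (Matrix.diagonal α) v)
              (mem_archLocal_comp_perm_iff_conj_mem L 3 α v ρ⁻¹)))) ∧
      ∀ (w : {w : InfinitePlace L // IsComplex w}) (ι : Type) [Fintype ι] (s : ι → ℂ) (μ : ι → ∀ v : {w : InfinitePlace L // IsComplex w}, Measure (archLocal L 3 (Matrix.diagonal α) v)),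
        (∀ i v, IsFiniteMeasureOnCompacts (μ i v) ∧ SigmaFinite (μ i v)) →
        Tendsto (fun ψ : ℝ => deriv (fun ψ : ℝ => (2 * Real.sin ψ : ℂ) * ∑ i, s i * ∑ ρ : Perm (Fin 3),
            (((∏ v : {w : InfinitePlace L // IsComplex w},
            (Finset.univ.filter fun i => 0 < (v.1.embedding (α i)).re).card.factorial *
              (3 - (Finset.univ.filter fun i => 0 < (v.1.embedding (α i)).re).card).factorial : ℕ) : ℂ)⁻¹ *
                ∫ o, Θ ((((archPiEquivCM 3 L (Matrix.diagonal α)).symm o : arch (↥(maximalRealSubfield L)) L (IsCMField.complexConj L) 3 (Matrix.diagonal α)) : GL (Fin 3) (mixedSpace L)) : Matrix (Fin 3) (Fin 3) (mixedSpace L)) ∂(Measure.pi (Function.update (μ i) w ((νw w).map fun y : archLocal L 3 (Matrix.diagonal α) w => y * (⟨circleDiagonal 3 ((fun j => z0 w j * Circle.exp (![(1 : ℝ), 0, -1] j * ψ)) ∘ ⇑ρ), circleDiagonal_mem_archLocal_diagonal L 3 α w ((fun j => z0 w j * Circle.exp (![(1 : ℝ), 0, -1] j * ψ)) ∘ ⇑ρ)⟩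 : archLocal L 3 (Matrix.diagonal α) w) * y⁻¹))))) ψ)
          (𝓝[>] 0)
          (𝓝 (∑ i, s i * ∑ ρ : Perm (Fin 3), (if 0 < (w.1.embedding (α (ρ⁻¹ 0))).re * (w.1.embedding (α (ρ⁻¹ 2))).re then (2 : ℂ) else c w ρ⁻¹) *
            (((∏ v : {w : InfinitePlace L // IsComplex w},
            (Finset.univ.filter fun i => 0 < (v.1.embedding (α i)).re).card.factorial *
              (3 - (Finset.univ.filter fun i => 0 < (v.1.embedding (α i)).re).card).factorial : ℕ) : ℂ)⁻¹ *
                ∫ o, Θ ((((archPiEquivCM 3 L (Matrix.diagonal α)).symm o : arch (↥(maximalRealSubfield L)) L (IsCMField.complexConj L) 3 (Matrix.diagonal α)) : GL (Fin 3) (mixedSpace L)) : Matrix (Fin 3) (Fin 3) (mixedSpace L)) ∂(Measure.pi (Function.update (μ i) w (if 0 < (w.1.embedding (α (ρ⁻¹ 0))).re * (w.1.embedding (α (ρ⁻¹ 2))).re then (νw w).map fun y : archLocal L 3 (Matrix.diagonal α) w => y * (⟨circleDiagonal 3 (z0 w ∘ ⇑ρ), circleDiagonal_mem_archLocal_diagonal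 L 3 α w (z0 w ∘ ⇑ρ)⟩ : archLocal L 3 (Matrix.diagonal α) w) * y⁻¹
              else ((quotientMeasure _ (νH w ρ⁻¹) (isClosed_coe_centralizer_singleton _) (ντ w ρ⁻¹)).map
                (descConj (⟨circleDiagonal 3 (z0 w), circleDiagonal_mem_archLocal_diagonal L 3 (α ∘ ⇑ρ⁻¹) w (z0 w)⟩ : archLocal L 3 (Matrix.diagonal (α ∘ ⇑ρ⁻¹)) w)
                  (Subgroup.centralizer ({(⟨circleDiagonal 3 (z₁ w), circleDiagonal_mem_archLocal_diagonal L 3 (α ∘ ⇑ρ⁻¹) w (z₁ w)⟩ :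
                    archLocal L 3 (Matrix.diagonal (α ∘ ⇑ρ⁻¹)) w)} : Set (archLocal L 3 (Matrix.diagonal (α ∘ ⇑ρ⁻¹)) w)))
                  (forall_mem_centralizer_circleDiagonal_comm_of_wall L (α ∘ ⇑ρ⁻¹) w (h02 w) (h01 w) (hwall w).1 (hwall w).2) id)).map
                (ContinuousMulEquiv.restrictSubgroup (GLn.conjEquiv (Matrix.GeneralLinearGroup.mkOfDetNeZero _ (det_monomial_one_ne_zero 3 ρ⁻¹)))
              (archLocal L 3 (Matrix.diagonal (α ∘ ⇑ρ⁻¹)) w) (archLocal L 3 (Matrix.diagonal α) w)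
              (mem_archLocal_comp_perm_iff_conj_mem L 3 α w ρ⁻¹)))))))) := by
  classical
  haveI hLCv : ∀ v : {w : InfinitePlace L // IsComplex w}, LocallyCompactSpace (archLocal L 3 (Matrix.diagonal α) v) := fun v => locallyCompactSpace_archLocal L 3 (Matrix.diagonal α) v
  haveI hSCv : ∀ v : {w : InfinitePlace L // IsComplex w}, SecondCountableTopology (archLocal L 3 (Matrix.diagonal α) v) := fun v => secondCountableTopology_archLocal L 3 (Matrix.diagonal α) v
  haveI hLC : ∀ (v : {w : InfinitePlace L // IsComplex w}) (τ : Perm (Fin 3)), LocallyCompactSpace (archLocal L 3 (Matrix.diagonal (α ∘ ⇑τ)) v) :=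
    fun v τ => locallyCompactSpace_archLocal L 3 (Matrix.diagonal (α ∘ ⇑τ)) v
  haveI hSC : ∀ (v : {w : InfinitePlace L // IsComplex w}) (τ : Perm (Fin 3)), SecondCountableTopology (archLocal L 3 (Matrix.diagonal (α ∘ ⇑τ)) v) :=
    fun v τ => secondCountableTopology_archLocal L 3 (Matrix.diagonal (α ∘ ⇑τ)) v
  have hreal : ∀ (v : {w : InfinitePlace L // IsComplex w}) (i : Fin 3), (v.1.embedding (α i)).im = 0 := fun v i => im_embedding_eq_zero_of_complexConj_eq L v (hherm i)
  -- J1's constants, place by place (★ p841638, opaque transported measures)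
  intro hcl
  have hpl := fun (w : {w : InfinitePlace L // IsComplex w}) (_h1 : (νw w).IsHaarMeasure) (_h2 : (νw w).IsMulRightInvariant)
      (_h3 : ∀ τ : Perm (Fin 3), (νH w τ).IsHaarMeasure) (_h4 : ∀ τ : Perm (Fin 3), (νH w τ).IsInvInvariant)
      (_h5 : ∀ τ : Perm (Fin 3), (ντ w τ).IsHaarMeasure) (_h6 : ∀ τ : Perm (Fin 3), (ντ w τ).IsMulRightInvariant) =>
    tendsto_deriv_sin_mul_sum_sum_integral_pi_update_splitCurve_of_eq_of_clause L α w hα hherm (νw w) (z₁ w) (h02 w) (h01 w) (νH w) (ντ w) (by rw [hντ]) (c w) (hcl w)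
  have hJ := fun w : {w : InfinitePlace L // IsComplex w} =>
    hpl w (hνw w).1 (hνw w).2 (fun τ => (hνH w τ).1) (fun τ => (hνH w τ).2) (fun τ => (hντi w τ).1) (fun τ => (hντi w τ).2)
  refine ⟨fun v ρ => ?_, fun w ι _ s μ hμ => ?_⟩
  · -- the wall measures are Radon
    by_cases hcw : 0 < (v.1.embedding (α (ρ⁻¹ 0))).re * (v.1.embedding (α (ρ⁻¹ 2))).re
    · rw [if_pos hcw]
      haveI : IsFiniteMeasureOnCompacts (νw v) := (hνw v).1.toIsFiniteMeasureOnCompacts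
      haveI hfc := isFiniteMeasureOnCompacts_map_conj_of_proper L 3 α v (νw v) _ fun C hC =>
        isCompact_setOf_conj_circleDiagonal_comp_perm_mem_of_compactWall L α v hα (hreal v) (z0 v) (hwall v).1 (hwall v).2 ρ hcw C hC
      haveI hlf : IsLocallyFiniteMeasure ((νw v).map fun y : archLocal L 3 (Matrix.diagonal α) v =>
          y * (⟨circleDiagonal 3 (z0 v ∘ ⇑ρ), circleDiagonal_mem_archLocal_diagonal L 3 α v (z0 v ∘ ⇑ρ)⟩ : archLocal L 3 (Matrix.diagonal α) v) * y⁻¹) :=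
        isLocallyFiniteMeasure_of_isFiniteMeasureOnCompacts
      exact ⟨hfc, sigmaFinite_of_locallyFinite⟩
    · rw [if_neg hcw]
      haveI := (hνH v ρ⁻¹).1; haveI := (hνH v ρ⁻¹).2; haveI := (hντi v ρ⁻¹).1; haveI := (hντi v ρ⁻¹).2
      have hdet : (Matrix.diagonal (α ∘ ⇑ρ⁻¹)).det ≠ 0 := by
        rw [Matrix.det_diagonal]; exact Finset.prod_ne_zero_iff.mpr fun i _ => hα _
      have hab : ((z0 v 0 : Circle) : ℂ) ≠ z0 v 1 := fun h => (hwall v).2 (Subtype.val_injective h)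
      have hO := isClosed_conjClass_archLocal_of_mul_sub_eq_zero L 3 (Matrix.diagonal (α ∘ ⇑ρ⁻¹)) v
        (map_cmConjRingHom_transpose_diagonal L (α ∘ ⇑ρ⁻¹) fun i => hherm _) hdet
        (⟨circleDiagonal 3 (z0 v), circleDiagonal_mem_archLocal_diagonal L 3 (α ∘ ⇑ρ⁻¹) v (z0 v)⟩ : archLocal L 3 (Matrix.diagonal (α ∘ ⇑ρ⁻¹)) v)
        hab (mul_sub_eq_zero_circleDiagonal_wall L (α ∘ ⇑ρ⁻¹) v (hwall v).1)
      have hMeq := centralizer_circleDiagonal_eq_of_wall L (α ∘ ⇑ρ⁻¹) v (h02 v) (h01 v) (hwall v).1 (hwall v).2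
      haveI := isFiniteMeasureOnCompacts_map_map_descConj_id _ _
        (forall_mem_centralizer_circleDiagonal_comm_of_wall L (α ∘ ⇑ρ⁻¹) v (h02 v) (h01 v) (hwall v).1 (hwall v).2) hO hMeq
        (quotientMeasure _ (νH v ρ⁻¹) (isClosed_coe_centralizer_singleton _) (ντ v ρ⁻¹))
        (ContinuousMulEquiv.restrictSubgroup (GLn.conjEquiv (Matrix.GeneralLinearGroup.mkOfDetNeZero _ (det_monomial_one_ne_zero 3 ρ⁻¹)))
              (archLocal L 3 (Matrix.diagonal (α ∘ ⇑ρ⁻¹)) v) (archLocal L 3 (Matrix.diagonal α) v)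
              (mem_archLocal_comp_perm_iff_conj_mem L 3 α v ρ⁻¹))
      haveI hlf : IsLocallyFiniteMeasure (((quotientMeasure _ (νH v ρ⁻¹) (isClosed_coe_centralizer_singleton _) (ντ v ρ⁻¹)).map
                (descConj (⟨circleDiagonal 3 (z0 v), circleDiagonal_mem_archLocal_diagonal L 3 (α ∘ ⇑ρ⁻¹) v (z0 v)⟩ : archLocal L 3 (Matrix.diagonal (α ∘ ⇑ρ⁻¹)) v)
                  (Subgroup.centralizer ({(⟨circleDiagonal 3 (z₁ v), circleDiagonal_mem_archLocal_diagonal L 3 (α ∘ ⇑ρ⁻¹) v (z₁ v)⟩ :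
                    archLocal L 3 (Matrix.diagonal (α ∘ ⇑ρ⁻¹)) v)} : Set (archLocal L 3 (Matrix.diagonal (α ∘ ⇑ρ⁻¹)) v)))
                  (forall_mem_centralizer_circleDiagonal_comm_of_wall L (α ∘ ⇑ρ⁻¹) v (h02 v) (h01 v) (hwall v).1 (hwall v).2) id)).map
                (ContinuousMulEquiv.restrictSubgroup (GLn.conjEquiv (Matrix.GeneralLinearGroup.mkOfDetNeZero _ (det_monomial_one_ne_zero 3 ρ⁻¹)))
              (archLocal L 3 (Matrix.diagonal (α ∘ ⇑ρ⁻¹)) v) (archLocal L 3 (Matrix.diagonal α) v)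
              (mem_archLocal_comp_perm_iff_conj_mem L 3 α v ρ⁻¹))) :=
        isLocallyFiniteMeasure_of_isFiniteMeasureOnCompacts
      exact ⟨this, sigmaFinite_of_locallyFinite⟩
  · -- the one-step jump for the scaled state: ★ p841638 with scalars `s i · K⁻¹`
    have h := hJ w Θ hΘ hΘc ι (fun i => s i * ((∏ v : {w : InfinitePlace L // IsComplex w},
            (Finset.univ.filter fun i => 0 < (v.1.embedding (α i)).re).card.factorial *
              (3 - (Finset.univ.filter fun i => 0 < (v.1.embedding (α i)).re).card).factorial : ℕ) : ℂ)⁻¹) μ hμ (z0 w) (hwall w).1 (hwall w).2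
    convert h using 2
    · congr 1
      funext ψ'
      congr 1
      refine Finset.sum_congr rfl fun i _ => ?_
      rw [Finset.mul_sum, Finset.mul_sum]
      exact Finset.sum_congr rfl fun ρ _ => by ring
    · refine Finset.sum_congr rfl fun i _ => ?_
      rw [Finset.mul_sum, Finset.mul_sum]
      exact Finset.sum_congr rfl fun ρ _ => by ring

end AllPlaces

end Literature.NumberTheory.Rogawski1990

end
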